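import Summits.Ventures.CertifiedManyBodySolver.Theorems.CovHg1201M19bPatchAdapters
import HarnessLib

/-!
# Theorems/CovHg1201M19bStubAdapters.lean — SEGMENT-SHAPED adapters for the REGISTERED STUBS of route `CovHg1201M19b`

Supports **stmt-Ventures-26186 `PatchLeftEdge`** (registered stubs `stub_leftEdge_lowU : LeftEdgeLowU` = the left-edge bundle on `U′ ∈ [7/2, 5]`,
`stub_leftEdge_highU : LeftEdgeHighU` on `U′ ∈ [5, 44/5]`; PEN g18 BC3 skeleton v2, evidence 2026-08-28T06:45:39Z) and **stmt-Ventures-26187 `PatchBottom`**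
(stubs `stub_bottom_nHigh : BottomNHigh` = `n ∈ [9/10, 183/200]`, `stub_bottom_nLow : BottomNLow` = `n ∈ [87/100, 9/10]`). The stub Props live in the skeleton,
not in the tree, so the theorems below conclude their UNFOLDED bodies with the segment ends as parameters — a stub worker closes a stub by
`theorem stub_leftEdge_lowU : LeftEdgeLowU := covHg1201M19b_leftEdgeSegment_of_boxRow (U₁ := 7/2) (U₂ := 5) …` (one `exact`), given:

* a `boxdual/0` TREE CELL `SquareTTPrimeCorrOrbitLowerBoxRow ![U₁, −27/50, n₁] ![U₂, −27/50, n₂] cap r univ (box 2 7) (−X₀(−27/50; Uo))` (hubbard-box-eng-3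
  `Rows/DopedTLCorrBox`, emitted by `boxdual.leannodes` from the U-SEGMENT read of record — captain RULING C-S1 2026-08-28T06:37:47Z; runner hubbard-cov-hg1201-sdp-2;
  vertices = its own-slot corner legs A7o2 / A5 / A44o5), its cap DISCHARGED on the cell, and `−r ≤ 0.5166800` ⇒ the left-edge bundle on `[U₁, U₂] × [n₁, n₂]`
  at EVERY slot `σ ∈ [−27/50, −13/25]` (`covHg1201M19b_leftEdgeSegment_of_boxRow`; corner-objective family version `…_of_cornerObjective`);
* the bottom analogue on a density segment: cell `![7/2, −27/50, n₁] ![7/2, −13/25, n₂]` ⇒ the bottom bundle on `n ∈ [n₁, n₂]` (`covHg1201M19b_bottomSegment_of_boxRow`;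
  `…_of_cornerObjective`) — `BottomNHigh` = `(n₁, n₂) = (9/10, 183/200)`, `BottomNLow` = `(87/100, 9/10)`.
Requirement `0 ≤ n₁`, `n₂ ≤ 183/200` (the state-free inner-END read `≥ −0.5152137` of hubbard-cov-hg1201-box-2 is typed up to the box's top filling).

All PROVED; zero solve, no definition, no claim node, no `sorry`. HONEST FRAMING: obligation-shape adapters, CONDITIONAL on box rows no certificate supplies yet;
wording class (xx1): certified stiffness CEILINGS on a downfolded box = CONTROL / CALIBRATION + labelled heuristic; «content» = below `0.98 ×` the kinematic MAJORANT
word, no suppression below free fermions claimed (interim bar rule); a ceiling never speaks to the presence of superconductivity; not a `T_c` or phase sentence;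
NO stub, NO item, NO rung leaf is proved here.

Cell `pub/hubbard-obs` (LADDER-HUBBARD MO-S2, D-0154 (1)(C) Hg-1201), seat `hubbard-cov-hg1201-box-1` (`prover-hubbard-cov-hg1201-box-1-0`; S1 U-segment reader owner).
References: T. Koma, H. Tasaki, J. Stat. Phys. 76 (1994) 745, §1 [KomaTasaki1994]; D. J. Scalapino, S. R. White, S.-C. Zhang, PRB 47 (1993) 7995, §II
[ScalapinoWhiteZhang1993]; S. Boyd, L. Vandenberghe, *Convex Optimization* (2004) §5.9 [BoydVandenberghe2004].
-/

noncomputable section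

namespace Summit.Ventures.CertifiedManyBodySolver.Theorems

open Real Set NonemptyInterval Filter Topology
open Summit.Ventures.CertifiedManyBodySolver.Observables
open Summit.Ventures.CertifiedManyBodySolver.Downfold
open Summit.Ventures.CertifiedManyBodySolver.Certificates
open Summit.Ventures.CertifiedManyBodySolver
open Literature.MathematicalPhysics.QuantumLattice Literature.MathematicalPhysics.QuantumLattice.ThermodynamicLimit
open Literature.Probability.LatticeModels
open Matrix HubbardWave0
open scoped BigOperators ComplexOrder

/-! ## §1 Left-edge U-SEGMENT bundles (the `LeftEdgeLowU` / `LeftEdgeHighU` stub shapes, segment ends free) -/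

/-- **Left-edge bundle on a `U`-segment `[U₁, U₂]` and density segment `[n₁, n₂] ⊆ [0, 183/200]` FROM CORNER-OBJECTIVE READS**: per `n ∈ [n₁, n₂]` and
`U′ ∈ [U₁, U₂]` an orbit-lower value `vL n U′` for `−X₀(−27/50, U′)` on the class at `(−27/50, U′, n)`, with `−vL n U′ ≤ 0.5166800` ⇒ the target-slot bundle at
EVERY `σ ∈ [−27/50, −13/25]` (the body of `LeftEdgeLowU` at `(U₁, U₂, n₁, n₂) = (7/2, 5, 87/100, 183/200)`, of `LeftEdgeHighU` at `(5, 44/5, 87/100, 183/200)`).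
[cite: KomaTasaki1994, §1] [cite: ScalapinoWhiteZhang1993, §II] -/
theorem covHg1201M19b_leftEdgeSegment_of_cornerObjective {U₁ U₂ n₁ n₂ : ℝ} (hn₁ : 0 ≤ n₁) (hn₂ : n₂ ≤ 183 / 200) (vL : ℝ → ℝ → ℝ)
    (hL : ∀ n ∈ Set.Icc n₁ n₂, ∀ U' ∈ Set.Icc U₁ U₂,
      ∀ (ω : InfVolFermionState 2) (Ls : ℕ → ℕ) (ψ : ∀ L, Fock (Orb (FermionTorus 2 L))),
      Tendsto Ls atTop atTop →
      (∀ j, IsGroundStateInSector (hubbardTorusTT' (Ls j) 1 (-27 / 50) U') (rectN n (Ls j)) 0 (ψ (Ls j))) →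
      (∀ j, star (ψ (Ls j)) ⬝ᵥ ψ (Ls j) = 1) → ω.IsTorusLimitOf ψ Ls →
      vL n U' ≤ ((Finset.univ : Finset (DihedralGroup 4)).card : ℝ)⁻¹ * ∑ g ∈ (Finset.univ : Finset (DihedralGroup 4)),
        (ω.expect (d4ShiftSet g 0 (box 2 7)) (fermionEmbed (PolySite.d4Emb g 0 (box 2 7)) (-oddMomentObsTT (-27 / 50) U' 0))).re)
    (hcL : ∀ n ∈ Set.Icc n₁ n₂, ∀ U' ∈ Set.Icc U₁ U₂, -vL n U' ≤ (5166800 / 10000000 : ℝ)) :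
    ∀ n ∈ Set.Icc n₁ n₂, ∀ σ ∈ Set.Icc (-27 / 50 : ℝ) (-13 / 25), ∀ U' ∈ Set.Icc U₁ U₂,
      ∀ (ω : InfVolFermionState 2) (Ls : ℕ → ℕ) (ψ : ∀ L, Fock (Orb (FermionTorus 2 L))),
      Tendsto Ls atTop atTop →
      (∀ j, IsGroundStateInSector (hubbardTorusTT' (Ls j) 1 (-27 / 50) U') (rectN n (Ls j)) 0 (ψ (Ls j))) →
      (∀ j, star (ψ (Ls j)) ⬝ᵥ ψ (Ls j) = 1) → ω.IsTorusLimitOf ψ Ls →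
      -(5166800 / 10000000 : ℝ) ≤ ((Finset.univ : Finset (DihedralGroup 4)).card : ℝ)⁻¹ * ∑ g ∈ (Finset.univ : Finset (DihedralGroup 4)),
        (ω.expect (d4ShiftSet g 0 (box 2 7)) (fermionEmbed (PolySite.d4Emb g 0 (box 2 7)) (-oddMomentObsTT σ U' 0))).re := by
  intro n hn σ hσ U' hU' ω Ls ψ hLs hψ h1 hω
  have hn0 : 0 ≤ n := hn₁.trans hn.1
  have hn' : n ≤ 183 / 200 := hn.2.trans hn₂
  have hn2 : n < 2 := by linarith
  have hKQc : -(-((43731 / 90112 : ℝ) * n / 2 + ((9 / 11 : ℝ) * 0.3123804228 + 2 / 11 * 0.2068368242))) ≤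
      (5166800 / 10000000 : ℝ) := by
    rw [neg_neg]
    have h := hg1201_innerKinematicReading_le hn'
    push_cast at h
    linarith
  have hchord := orbitLower_slot_chord_of_two_endObjectives hω.isTranslationInvariant U' (by norm_num : (-27 / 50 : ℝ) < -13 / 25) hσ
    (hL n hn U' hU' ω Ls ψ hLs hψ h1 hω)
    (orbitMean_neg_oddMomentTT_lam_zero_ge_kinematic_of_gs (-13 / 25) U' (-27 / 50) U' halfBathtub_m13o25_chordLevel_le
      hn0 hn2 ω Ls ψ hLs hψ h1 hω)
  obtain ⟨ha, hb, hab⟩ := hg1201_patch_slotWeights hσ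
  have hprice := neg_convexComb_le_of_neg_le ha hb hab (hcL n hn U' hU') hKQc
  linarith

/-- **Left-edge bundle on `[U₁, U₂] × [n₁, n₂]` FROM ONE U-SEGMENT BOX ROW** (router order `(U, t′, n)`; cell degenerate in `t′ = −27/50`): the tree cell
`SquareTTPrimeCorrOrbitLowerBoxRow ![U₁, −27/50, n₁] ![U₂, −27/50, n₂] cap r univ Λ₇ (−X₀(−27/50; Uo))`, cap discharged, `−r ≤ 0.5166800` ⇒ the bundle at every
slot. Stub usage: `stub_leftEdge_lowU := covHg1201M19b_leftEdgeSegment_of_boxRow (U₁ := 7/2) (U₂ := 5) (n₁ := 87/100) (n₂ := 183/200) (by norm_num) (by norm_num) Uo hrow hcap hr`.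
[cite: BoydVandenberghe2004, §5.9] [cite: KomaTasaki1994, §1] -/
theorem covHg1201M19b_leftEdgeSegment_of_boxRow {U₁ U₂ n₁ n₂ : ℝ} (hn₁ : 0 ≤ n₁) (hn₂ : n₂ ≤ 183 / 200)
    {cap : (Fin 3 → ℝ) → ℝ} {r : ℚ} (Uo : ℝ)
    (hrow : SquareTTPrimeCorrOrbitLowerBoxRow ![U₁, -27 / 50, n₁] ![U₂, -27 / 50, n₂] cap r Finset.univ (box 2 7)
      (-oddMomentObsTT (-27 / 50) Uo 0))
    (hcap : ∀ θ ∈ Set.Icc (![U₁, -27 / 50, n₁] : Fin 3 → ℝ) ![U₂, -27 / 50, n₂], energyDensityTT' 1 (θ 1) (θ 0) (θ 2) ≤ cap θ)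
    (hr : -((r : ℚ) : ℝ) ≤ (5166800 / 10000000 : ℝ)) :
    ∀ n ∈ Set.Icc n₁ n₂, ∀ σ ∈ Set.Icc (-27 / 50 : ℝ) (-13 / 25), ∀ U' ∈ Set.Icc U₁ U₂,
      ∀ (ω : InfVolFermionState 2) (Ls : ℕ → ℕ) (ψ : ∀ L, Fock (Orb (FermionTorus 2 L))),
      Tendsto Ls atTop atTop →
      (∀ j, IsGroundStateInSector (hubbardTorusTT' (Ls j) 1 (-27 / 50) U') (rectN n (Ls j)) 0 (ψ (Ls j))) →
      (∀ j, star (ψ (Ls j)) ⬝ᵥ ψ (Ls j) = 1) → ω.IsTorusLimitOf ψ Ls →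
      -(5166800 / 10000000 : ℝ) ≤ ((Finset.univ : Finset (DihedralGroup 4)).card : ℝ)⁻¹ * ∑ g ∈ (Finset.univ : Finset (DihedralGroup 4)),
        (ω.expect (d4ShiftSet g 0 (box 2 7)) (fermionEmbed (PolySite.d4Emb g 0 (box 2 7)) (-oddMomentObsTT σ U' 0))).re := by
  refine covHg1201M19b_leftEdgeSegment_of_cornerObjective hn₁ hn₂ (fun _ _ => ((r : ℚ) : ℝ))
    (fun n hn U' hU' ω Ls ψ hLs hψ h1 hω => ?_) (fun n hn U' hU' => hr)
  rw [covHg1201_neg_oddMomentObsTT_lam_zero_label (-27 / 50) U' Uo]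
  exact covHg1201_boxRow_orbitLower_at hrow hcap (covHg1201_vec3_mem_Icc hU'.1 hU'.2 le_rfl le_rfl hn.1 hn.2) ω Ls ψ hLs hψ h1 hω

/-! ## §2 Bottom t′-SEGMENT bundles on a density segment (the `BottomNHigh` / `BottomNLow` stub shapes) -/

/-- **Bottom bundle at `U = 7/2` on a density segment `[n₁, n₂] ⊆ [0, 183/200]` FROM CORNER-OBJECTIVE READS**: per `n ∈ [n₁, n₂]` and source
`s ∈ [−27/50, −13/25]` an orbit-lower value `vB n s` for `−X₀(−27/50, 7/2)` on the class at `(s, 7/2, n)`, `−vB n s ≤ 0.5166800` ⇒ the target-slot bottom bundle at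
every `σ ∈ [−27/50, −13/25]`, `s ∈ [−27/50, σ]` (the body of `BottomNHigh` at `(n₁, n₂) = (9/10, 183/200)`, of `BottomNLow` at `(87/100, 9/10)`).
[cite: KomaTasaki1994, §1] [cite: ScalapinoWhiteZhang1993, §II] -/
theorem covHg1201M19b_bottomSegment_of_cornerObjective {n₁ n₂ : ℝ} (hn₁ : 0 ≤ n₁) (hn₂ : n₂ ≤ 183 / 200) (vB : ℝ → ℝ → ℝ)
    (hB : ∀ n ∈ Set.Icc n₁ n₂, ∀ s ∈ Set.Icc (-27 / 50 : ℝ) (-13 / 25),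
      ∀ (ω : InfVolFermionState 2) (Ls : ℕ → ℕ) (ψ : ∀ L, Fock (Orb (FermionTorus 2 L))),
      Tendsto Ls atTop atTop →
      (∀ j, IsGroundStateInSector (hubbardTorusTT' (Ls j) 1 s (7 / 2)) (rectN n (Ls j)) 0 (ψ (Ls j))) →
      (∀ j, star (ψ (Ls j)) ⬝ᵥ ψ (Ls j) = 1) → ω.IsTorusLimitOf ψ Ls →
      vB n s ≤ ((Finset.univ : Finset (DihedralGroup 4)).card : ℝ)⁻¹ * ∑ g ∈ (Finset.univ : Finset (DihedralGroup 4)),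
        (ω.expect (d4ShiftSet g 0 (box 2 7)) (fermionEmbed (PolySite.d4Emb g 0 (box 2 7)) (-oddMomentObsTT (-27 / 50) (7 / 2) 0))).re)
    (hcB : ∀ n ∈ Set.Icc n₁ n₂, ∀ s ∈ Set.Icc (-27 / 50 : ℝ) (-13 / 25), -vB n s ≤ (5166800 / 10000000 : ℝ)) :
    ∀ n ∈ Set.Icc n₁ n₂, ∀ σ ∈ Set.Icc (-27 / 50 : ℝ) (-13 / 25), ∀ s ∈ Set.Icc (-27 / 50 : ℝ) σ,
      ∀ (ω : InfVolFermionState 2) (Ls : ℕ → ℕ) (ψ : ∀ L, Fock (Orb (FermionTorus 2 L))),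
      Tendsto Ls atTop atTop →
      (∀ j, IsGroundStateInSector (hubbardTorusTT' (Ls j) 1 s (7 / 2)) (rectN n (Ls j)) 0 (ψ (Ls j))) →
      (∀ j, star (ψ (Ls j)) ⬝ᵥ ψ (Ls j) = 1) → ω.IsTorusLimitOf ψ Ls →
      -(5166800 / 10000000 : ℝ) ≤ ((Finset.univ : Finset (DihedralGroup 4)).card : ℝ)⁻¹ * ∑ g ∈ (Finset.univ : Finset (DihedralGroup 4)),
        (ω.expect (d4ShiftSet g 0 (box 2 7)) (fermionEmbed (PolySite.d4Emb g 0 (box 2 7)) (-oddMomentObsTT σ (7 / 2) 0))).re := by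
  intro n hn σ hσ s hs ω Ls ψ hLs hψ h1 hω
  have hn0 : 0 ≤ n := hn₁.trans hn.1
  have hn' : n ≤ 183 / 200 := hn.2.trans hn₂
  have hn2 : n < 2 := by linarith
  have hsI : s ∈ Set.Icc (-27 / 50 : ℝ) (-13 / 25) := ⟨hs.1, hs.2.trans hσ.2⟩
  have hKQc : -(-((43731 / 90112 : ℝ) * n / 2 + ((9 / 11 : ℝ) * 0.3123804228 + 2 / 11 * 0.2068368242))) ≤
      (5166800 / 10000000 : ℝ) := by
    rw [neg_neg]
    have h := hg1201_innerKinematicReading_le hn'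
    push_cast at h
    linarith
  have hchord := orbitLower_slot_chord_of_two_endObjectives hω.isTranslationInvariant (7 / 2) (by norm_num : (-27 / 50 : ℝ) < -13 / 25) hσ
    (hB n hn s hsI ω Ls ψ hLs hψ h1 hω)
    (orbitMean_neg_oddMomentTT_lam_zero_ge_kinematic_of_gs (-13 / 25) (7 / 2) s (7 / 2) halfBathtub_m13o25_chordLevel_le
      hn0 hn2 ω Ls ψ hLs hψ h1 hω)
  obtain ⟨ha, hb, hab⟩ := hg1201_patch_slotWeights hσ
  have hprice := neg_convexComb_le_of_neg_le ha hb hab (hcB n hn s hsI) hKQc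
  linarith

/-- **Bottom bundle on `n ∈ [n₁, n₂]` FROM ONE t′-SEGMENT BOX ROW at `U = 7/2`**: the tree cell `SquareTTPrimeCorrOrbitLowerBoxRow ![7/2, −27/50, n₁] ![7/2, −13/25, n₂] cap r univ
Λ₇ (−X₀(−27/50; Uo))`, cap discharged, `−r ≤ 0.5166800` ⇒ the bottom bundle at every slot. Stub usage: `stub_bottom_nHigh := covHg1201M19b_bottomSegment_of_boxRow
(n₁ := 9/10) (n₂ := 183/200) (by norm_num) (by norm_num) Uo hrow hcap hr`. [cite: BoydVandenberghe2004, §5.9] [cite: KomaTasaki1994, §1] -/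
theorem covHg1201M19b_bottomSegment_of_boxRow {n₁ n₂ : ℝ} (hn₁ : 0 ≤ n₁) (hn₂ : n₂ ≤ 183 / 200)
    {cap : (Fin 3 → ℝ) → ℝ} {r : ℚ} (Uo : ℝ)
    (hrow : SquareTTPrimeCorrOrbitLowerBoxRow ![7 / 2, -27 / 50, n₁] ![7 / 2, -13 / 25, n₂] cap r Finset.univ (box 2 7)
      (-oddMomentObsTT (-27 / 50) Uo 0))
    (hcap : ∀ θ ∈ Set.Icc (![7 / 2, -27 / 50, n₁] : Fin 3 → ℝ) ![7 / 2, -13 / 25, n₂], energyDensityTT' 1 (θ 1) (θ 0) (θ 2) ≤ cap θ)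
    (hr : -((r : ℚ) : ℝ) ≤ (5166800 / 10000000 : ℝ)) :
    ∀ n ∈ Set.Icc n₁ n₂, ∀ σ ∈ Set.Icc (-27 / 50 : ℝ) (-13 / 25), ∀ s ∈ Set.Icc (-27 / 50 : ℝ) σ,
      ∀ (ω : InfVolFermionState 2) (Ls : ℕ → ℕ) (ψ : ∀ L, Fock (Orb (FermionTorus 2 L))),
      Tendsto Ls atTop atTop →
      (∀ j, IsGroundStateInSector (hubbardTorusTT' (Ls j) 1 s (7 / 2)) (rectN n (Ls j)) 0 (ψ (Ls j))) →
      (∀ j, star (ψ (Ls j)) ⬝ᵥ ψ (Ls j) = 1) → ω.IsTorusLimitOf ψ Ls →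
      -(5166800 / 10000000 : ℝ) ≤ ((Finset.univ : Finset (DihedralGroup 4)).card : ℝ)⁻¹ * ∑ g ∈ (Finset.univ : Finset (DihedralGroup 4)),
        (ω.expect (d4ShiftSet g 0 (box 2 7)) (fermionEmbed (PolySite.d4Emb g 0 (box 2 7)) (-oddMomentObsTT σ (7 / 2) 0))).re := by
  refine covHg1201M19b_bottomSegment_of_cornerObjective hn₁ hn₂ (fun _ _ => ((r : ℚ) : ℝ))
    (fun n hn s hs ω Ls ψ hLs hψ h1 hω => ?_) (fun n hn s hs => hr)
  rw [covHg1201_neg_oddMomentObsTT_lam_zero_label (-27 / 50) (7 / 2) Uo]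
  exact covHg1201_boxRow_orbitLower_at hrow hcap (covHg1201_vec3_mem_Icc le_rfl le_rfl hs.1 hs.2 hn.1 hn.2) ω Ls ψ hLs hψ h1 hω

/-! ## §3 The PEN's stub bodies at their literal segment ends (sanity instances; the stubs themselves are proved in the skeleton by these `exact`s) -/

/-- `LeftEdgeLowU`'s body (`U′ ∈ [7/2, 5]`, `n ∈ [87/100, 183/200]`) from one U-segment box row on `![7/2, −27/50, 87/100] ![5, −27/50, 183/200]`. [cite: BoydVandenberghe2004, §5.9] -/
theorem covHg1201M19b_leftEdgeLowU_body_of_boxRow {cap : (Fin 3 → ℝ) → ℝ} {r : ℚ} (Uo : ℝ)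
    (hrow : SquareTTPrimeCorrOrbitLowerBoxRow ![7 / 2, -27 / 50, 87 / 100] ![5, -27 / 50, 183 / 200] cap r Finset.univ (box 2 7)
      (-oddMomentObsTT (-27 / 50) Uo 0))
    (hcap : ∀ θ ∈ Set.Icc (![7 / 2, -27 / 50, 87 / 100] : Fin 3 → ℝ) ![5, -27 / 50, 183 / 200],
      energyDensityTT' 1 (θ 1) (θ 0) (θ 2) ≤ cap θ)
    (hr : -((r : ℚ) : ℝ) ≤ (5166800 / 10000000 : ℝ)) :
    ∀ n ∈ Set.Icc (87 / 100 : ℝ) (183 / 200), ∀ σ ∈ Set.Icc (-27 / 50 : ℝ) (-13 / 25), ∀ U' ∈ Set.Icc (7 / 2 : ℝ) 5,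
      ∀ (ω : InfVolFermionState 2) (Ls : ℕ → ℕ) (ψ : ∀ L, Fock (Orb (FermionTorus 2 L))),
      Tendsto Ls atTop atTop →
      (∀ j, IsGroundStateInSector (hubbardTorusTT' (Ls j) 1 (-27 / 50) U') (rectN n (Ls j)) 0 (ψ (Ls j))) →
      (∀ j, star (ψ (Ls j)) ⬝ᵥ ψ (Ls j) = 1) → ω.IsTorusLimitOf ψ Ls →
      -(5166800 / 10000000 : ℝ) ≤ ((Finset.univ : Finset (DihedralGroup 4)).card : ℝ)⁻¹ * ∑ g ∈ (Finset.univ : Finset (DihedralGroup 4)),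
        (ω.expect (d4ShiftSet g 0 (box 2 7)) (fermionEmbed (PolySite.d4Emb g 0 (box 2 7)) (-oddMomentObsTT σ U' 0))).re :=
  covHg1201M19b_leftEdgeSegment_of_boxRow (by norm_num) le_rfl Uo hrow hcap hr

/-- `BottomNHigh`'s body (`n ∈ [9/10, 183/200]`) from one t′-segment box row on `![7/2, −27/50, 9/10] ![7/2, −13/25, 183/200]`. [cite: BoydVandenberghe2004, §5.9] -/
theorem covHg1201M19b_bottomNHigh_body_of_boxRow {cap : (Fin 3 → ℝ) → ℝ} {r : ℚ} (Uo : ℝ)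
    (hrow : SquareTTPrimeCorrOrbitLowerBoxRow ![7 / 2, -27 / 50, 9 / 10] ![7 / 2, -13 / 25, 183 / 200] cap r Finset.univ (box 2 7)
      (-oddMomentObsTT (-27 / 50) Uo 0))
    (hcap : ∀ θ ∈ Set.Icc (![7 / 2, -27 / 50, 9 / 10] : Fin 3 → ℝ) ![7 / 2, -13 / 25, 183 / 200],
      energyDensityTT' 1 (θ 1) (θ 0) (θ 2) ≤ cap θ)
    (hr : -((r : ℚ) : ℝ) ≤ (5166800 / 10000000 : ℝ)) :
    ∀ n ∈ Set.Icc (9 / 10 : ℝ) (183 / 200), ∀ σ ∈ Set.Icc (-27 / 50 : ℝ) (-13 / 25), ∀ s ∈ Set.Icc (-27 / 50 : ℝ) σ,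
      ∀ (ω : InfVolFermionState 2) (Ls : ℕ → ℕ) (ψ : ∀ L, Fock (Orb (FermionTorus 2 L))),
      Tendsto Ls atTop atTop →
      (∀ j, IsGroundStateInSector (hubbardTorusTT' (Ls j) 1 s (7 / 2)) (rectN n (Ls j)) 0 (ψ (Ls j))) →
      (∀ j, star (ψ (Ls j)) ⬝ᵥ ψ (Ls j) = 1) → ω.IsTorusLimitOf ψ Ls →
      -(5166800 / 10000000 : ℝ) ≤ ((Finset.univ : Finset (DihedralGroup 4)).card : ℝ)⁻¹ * ∑ g ∈ (Finset.univ : Finset (DihedralGroup 4)),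
        (ω.expect (d4ShiftSet g 0 (box 2 7)) (fermionEmbed (PolySite.d4Emb g 0 (box 2 7)) (-oddMomentObsTT σ (7 / 2) 0))).re :=
  covHg1201M19b_bottomSegment_of_boxRow (by norm_num) le_rfl Uo hrow hcap hr

end Summit.Ventures.CertifiedManyBodySolver.Theorems

end
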